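import Summits.ResolutionOfSingularities.ResolutionOfSingularities.Theses.UniversalCells
import Literature.AlgebraicGeometry.Resolution.ResolutionLocalization
import Literature.AlgebraicGeometry.Resolution.PrincipalizationToResolution
import Summits.ResolutionOfSingularities.ResolutionOfSingularities.Theorems.UniversalCellsProductDescentResolutionPullback
import Summits.ResolutionOfSingularities.ResolutionOfSingularities.Theorems.UniversalCellsProductDescentGenericFibreEmbedding
import Summits.ResolutionOfSingularities.ResolutionOfSingularities.Theorems.UniversalCellsProductDescentFibreGenericPoint
import Summits.ResolutionOfSingularities.ResolutionOfSingularities.Theorems.UniversalCellsProductDescentPthPowerSliceAlgebra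
import Summits.ResolutionOfSingularities.ResolutionOfSingularities.Theorems.UniversalCellsProductDescentComponentsClopen
import Summits.ResolutionOfSingularities.ResolutionOfSingularities.Theorems.UniversalCellsProductDescentSliceRegular
import Summits.ResolutionOfSingularities.ResolutionOfSingularities.Theorems.UniversalCellsProductDescentSliceResolution
import Summits.ResolutionOfSingularities.ResolutionOfSingularities.Theorems.UniversalCellsProductDescentSliceWiggle
import HarnessLib

/-!
# Crux `ProductDescent` (stmt-ResolutionOfSingularities-15231) — line `birth`, lead's skeleton (rev L7: ALL true stubs landed; one open stub `stub_separabilisation`)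

Route `ResolutionOfSingularities/UniversalCells`, crux #3 (rank 3): PRODUCT DESCENT, local form —
for `Y` integral separated of finite type over the prime field `𝔽_p = ZMod p`, `W ↪ 𝔸ˢ_Y` open,
`w ∈ W` over `y ∈ Y`: a resolvable open neighbourhood of `w` gives a resolvable open
neighbourhood of `y`.

## rev L5: the `p`-TH POWER SECTION cut (lead, 2026-08-17)

Wave 1 closed the generic-fibre transfer (3 stubs landed, kept below as side results) and
returned `stub-blocked` on finite-field descent (Galois descent of existence-only resolutions,
the open gap `FiniteDescentOfResolutions` shared with crux `DescentAlgclosedToPerfect`). The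
lead's analysis of the remaining stub `goodSpecialisation` splits the barrier
`InseparableBaseChange` ("every closed slice `t = a` of a regular `Ũ → 𝔸ˢ_{𝔽_p}` may be
singular, and good slices may exist only over `𝔽_q ⊋ 𝔽_p`") into two halves and EVADES ONE:

* RATIONALITY HALF — evaded. Do not slice at a constant `t = a`; slice along a `p`-TH POWER
  SECTION `t = g(y)ᵖ`, `g ∈ Γ(V, 𝒪_Y)`: since `d(gᵖ) = 0` in characteristic `p`, at every point
  `x` of the total space `X₁` where `X₁ → 𝔸ˢ_{𝔽_p}` is SMOOTH the equations `tᵢ - gᵢᵖ` have the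
  same differentials `dtᵢ` as a constant slice, hence are part of a regular system of parameters
  (`stub_pthPowerSliceAlgebra`: Jacobi–Zariski for `𝔽_p → 𝔽_p[t] → 𝒪_{X₁,x}` + Matsumura 14.2,
  in tree as `isRegularLocalRing_quotient_span_range`), so the sliced scheme
  `X_σ := X₁ ×_{𝔸ˢ_Y} V` is REGULAR over a neighbourhood of `y` (`stub_sliceRegular`), proper and
  — after wiggling `g` inside `g + 𝔪_y` so that the section's generic value misses the
  exceptional image (`stub_sliceWiggle`, Zariski density of `p`-th powers) and discarding the
  clopen components of the regular `X_σ` that miss the isomorphism locus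
  (`stub_componentsClopen`) — birational onto an open `U ∋ y` of `Y` (`stub_sliceResolution`).
  No finite-field extension, no Galois descent: the value `σ(y) = (gᵢ(y)ᵖ)` reaches every
  `κ(y)`-rational point of the fibre with `p`-th power coordinates (all of them when `y` is closed).
* SEPARABILISATION HALF — the open core, isolated as `stub_separabilisation`: from the crux data
  produce SOME local resolution `π : X₁ → V₁ ⊆ 𝔸ˢ_Y` and a `p`-th power section value
  `b = σ(y) ∈ V₁` over `y` such that `X₁ → 𝔸ˢ_{𝔽_p}` is smooth at every point of `π⁻¹(b)`.
  For a FIXED resolution this can fail exactly when the image of the non-smooth locus contains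
  the whole fibre `(V₁)_y` (the planner's `w·y + uᵖ = 0` example, correctly placed over a
  singular point: blow up a centre `{t = uᵖ}` inside `E × 𝔸¹`, `E` exceptional over `y`), or,
  for closed `y`, when `(W')_y` has no `κ(y)`-rational point (then a finite constant-field
  extension and the blocked finite-field descent would be needed); it is implied by the summit
  (take the constant family over a resolved neighbourhood), hence irrefutable, and with the true
  stubs it implies the crux.

Chain (kernel-checked): `ProductDescent` ⟸ [y generic: the regular locus is open,
`isOpen_regularLocus_of_locallyOfFiniteType` + `Stacks07QW_field_holds`] / [y not generic:
`stub_separabilisation` → `stub_sliceWiggle` → `stub_sliceRegular` → `stub_sliceResolution`];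
`stub_pthPowerSliceAlgebra` and `stub_componentsClopen` are the algebra/topology lemmas used by the
provers of `stub_sliceRegular` / `stub_sliceResolution`.

STATUS rev L7 (2026-08-17, after wave 2): EVERY TRUE STUB HAS LANDED — `stub_pthPowerSliceAlgebra`
(p151341), `stub_componentsClopen` (p151075), `stub_sliceResolution` (p151654), `stub_sliceRegular`
(p153336), `stub_sliceWiggle` (p154192, corrected: hypothesis `σ_g(y) ∈ V₁` added, the rev-L5 form
being false for `V₁ = ⊥`) — and the whole chain is the landed conditional theorem
`Theorems.ProductDescent.Birth.ProductDescent_of_separabilisation` (p154192). The ONLY `sorry` left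
is `stub_separabilisation`, the crux's core. Lead's verdict (crux workfile
`Lines/birth-separabilisation-verdict.md`): crux-sized — implied by the summit, implies the crux,
and NOT reachable by modifying the given resolution (example `Bl_C Bl_L 𝔸³`, `C = {λᵖ = t} ⊂ E`:
by the factorisation of proper birational morphisms of regular surfaces every `X₁` dominating the
given `Ũ` has non-smooth points over every p-th power point `b` over `y`) — promote.

Side results kept from rev L3 (landed, wave 1): `stub_resolutionPullback` (p147873),
`stub_genericFibreEmbedding` (p148881), `stub_fibreGenericPoint` (p147981) and the derived
`genericFibre` (generic-fibre transfer, EGA IV₃ 8.10.5) — the entry point for a prover of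
`stub_separabilisation` who wants to start from the generic fibre `Y_{𝔽_p(t)}` and spread out
(`Literature/AlgebraicGeometry/Limits/Localization*Spread.lean`).

Disproof used: none on file for this crux (2026-08-17).
-/

noncomputable section

-- single-problem summit: the doubled namespace component `ResolutionOfSingularities` is forced
set_option linter.dupNamespace false

open CategoryTheory CategoryTheory.Limits AlgebraicGeometry Literature.AlgebraicGeometry.Resolution
open Summit.ResolutionOfSingularities.ResolutionOfSingularities.Theses.UniversalCells (ProductDescent)

namespace Summit.ResolutionOfSingularities.ResolutionOfSingularities.Cruxes.ProductDescent.Lines.Birth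

/-! ## The stubs of the `p`-th power section cut (registered signatures; prove EXACTLY these,
with the `open`s above) -/

/-- **STUB (OPEN — the crux's core: SEPARABILISATION with a rational `p`-th power point).** From
the crux data produce a local resolution `π : X₁ → V₁` of an open `V₁ ⊆ 𝔸ˢ_Y`, an open `V ∋ y`
of `Y` and sections `g : Fin s → Γ(V, 𝒪_Y)` such that the value `b := σ(y)` of the `p`-th power
section `σ = (gᵢᵖ)ᵢ : V → 𝔸ˢ_Y` lies in `V₁` and the composite `X₁ → 𝔸ˢ_{𝔽_p}` is smooth at
every point of `π⁻¹(b)` (re-resolution allowed; implied by the summit; false for a fixed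
resolution whose non-smooth locus swallows the fibre over `y` — barrier
`Literature.Barriers.ResolutionOfSingularities.InseparableBaseChange`, separabilisation half).
[cite: Hu2021, §9 p. 64; EGAIV4, 17.11.1] -/
theorem stub_separabilisation :
    ∀ p : ℕ, p.Prime → ∀ (Y : Scheme.{0}) (f : Y ⟶ Spec (.of (ZMod p))),
      IsSeparated f → LocallyOfFiniteType f → QuasiCompact f → IsIntegral Y →
      ∀ (s : ℕ) (W : Scheme.{0}) (j : W ⟶ AffineSpace (Fin s) Y), IsOpenImmersion j →
      ∀ w : W, (∃ W' : W.Opens, w ∈ W' ∧ Scheme.HasResolution (W' : Scheme.{0})) →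
      ∃ (V₁ : (AffineSpace (Fin s) Y).Opens) (X₁ : Scheme.{0}) (π : X₁ ⟶ (V₁ : Scheme.{0})),
        IsResolution π ∧
        ∃ (V : Y.Opens) (hyV : (CategoryTheory.over (AffineSpace (Fin s) Y) Y).base (j.base w) ∈ V)
          (g : Fin s → Γ((V : Scheme.{0}), ⊤)),
          (AffineSpace.homOfVector V.ι (fun i => g i ^ p)).base ⟨_, hyV⟩ ∈ V₁ ∧
          ∃ _ : LocallyOfFinitePresentation (π ≫ V₁.ι ≫ AffineSpace.map (Fin s) f),
            ∀ x : X₁, (π ≫ V₁.ι).base x =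
                (AffineSpace.homOfVector V.ι (fun i => g i ^ p)).base ⟨_, hyV⟩ →
              x ∈ (π ≫ V₁.ι ≫ AffineSpace.map (Fin s) f).smoothLocus := by
  sorry

/-- **CLOSED STUB (landed p154192, `Theorems/UniversalCellsProductDescentSliceWiggle.lean`; corrected rev L6: hypothesis `σ(y) ∈ V₁` added — the rev-L5 form was
false for `V₁ = ⊥`, worker's Lean counterexample `Y = Spec ℤ`): WIGGLING THE SECTION.** For `y`
not the generic point of the integral
scheme `Y`, a section value `σ(y)` can be kept while moving the generic value `σ(η_Y)` of a
`p`-th power section into any given isomorphism locus of a birational `π : X₁ → V₁ ⊆ 𝔸ˢ_Y`: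
replace `g` by `g + h` with `h ∈ 𝔪_y` on an affine neighbourhood `V' = Spec A` of `y`
(`𝔪_y ≠ 0` is infinite as `A` is a domain and not a field, and a non-zero polynomial over the
domain `A` does not vanish on all of `𝔪_yˢ`). [folklore] -/
theorem stub_sliceWiggle :
    ∀ p : ℕ, p.Prime → ∀ (Y : Scheme.{0}) [IsIntegral Y] (s : ℕ) (V₁ : (AffineSpace (Fin s) Y).Opens)
      (X₁ : Scheme.{0}) (π : X₁ ⟶ (V₁ : Scheme.{0})), IsBirational π →
      ∀ (V : Y.Opens) (y : Y) (hyV : y ∈ V), y ≠ genericPoint Y →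
      ∀ g : Fin s → Γ((V : Scheme.{0}), ⊤),
      (AffineSpace.homOfVector V.ι (fun i => g i ^ p)).base ⟨y, hyV⟩ ∈ V₁ →
      ∃ (V' : Y.Opens) (hyV' : y ∈ V') (g' : Fin s → Γ((V' : Scheme.{0}), ⊤)),
        (AffineSpace.homOfVector V'.ι (fun i => g' i ^ p)).base ⟨y, hyV'⟩ =
          (AffineSpace.homOfVector V.ι (fun i => g i ^ p)).base ⟨y, hyV⟩ ∧
        ∃ Ω : (AffineSpace (Fin s) Y).Opens, Ω ≤ V₁ ∧ IsIso (π ∣_ (V₁.ι ⁻¹ᵁ Ω)) ∧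
          ∀ x : (V' : Scheme.{0}), V'.ι.base x = genericPoint Y →
            (AffineSpace.homOfVector V'.ι (fun i => g' i ^ p)).base x ∈ Ω :=
  Summit.ResolutionOfSingularities.ResolutionOfSingularities.Theorems.ProductDescent.Birth.stub_sliceWiggle

/-- **CLOSED STUB (landed p151341, `Theorems/UniversalCellsProductDescentPthPowerSliceAlgebra.lean`) THE `p`-TH POWER SLICING LEMMA (local algebra).** If `S` is a regular
local ring, formally smooth over `𝔽_p[X₁,…,X_s]`, and `gᵢ ∈ S` with `Xᵢ - gᵢᵖ ∈ 𝔪_S`, then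
`S/(Xᵢ - gᵢᵖ)ᵢ` is a regular local ring: by Jacobi–Zariski for `𝔽_p → 𝔽_p[X] → S`
(`Algebra.H1Cotangent.exact_δ_mapBaseChange`, `H¹ = 0` by formal smoothness) the `dXᵢ` stay
linearly independent in `κ ⊗ Ω_{S/𝔽_p}`, `d(gᵖ) = 0`, so the `Xᵢ - gᵢᵖ` have independent images
in `𝔪/𝔪²` (`KaehlerDifferential.kerCotangentToTensor`) and Matsumura 14.2
(`isRegularLocalRing_quotient_span_range`) applies. [cite: Matsumura1987, Thm. 14.2] -/
theorem stub_pthPowerSliceAlgebra :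
    ∀ (p : ℕ), p.Prime → ∀ (s : ℕ) (S : Type) [CommRing S] [IsRegularLocalRing S]
      [Algebra (MvPolynomial (Fin s) (ZMod p)) S]
      [Algebra.FormallySmooth (MvPolynomial (Fin s) (ZMod p)) S] (g : Fin s → S),
      (∀ i, algebraMap (MvPolynomial (Fin s) (ZMod p)) S (MvPolynomial.X i) - g i ^ p ∈
          IsLocalRing.maximalIdeal S) →
      IsRegularLocalRing (S ⧸ Ideal.span (Set.range fun i =>
        algebraMap (MvPolynomial (Fin s) (ZMod p)) S (MvPolynomial.X i) - g i ^ p)) :=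
  Summit.ResolutionOfSingularities.ResolutionOfSingularities.Theorems.ProductDescent.Birth.stub_pthPowerSliceAlgebra

/-- **CLOSED STUB (landed p153336, `Theorems/UniversalCellsProductDescentSliceRegular.lean`) THE SLICED SCHEME IS REGULAR NEAR THE FIBRE.** With `σ = (gᵢᵖ)ᵢ : V → 𝔸ˢ_Y`
and `X_σ := X₁ ×_{𝔸ˢ_Y} V` (pull back `π ≫ V₁.ι` along `σ`): if `X₁` is regular, `π` proper and
`X₁ → 𝔸ˢ_{𝔽_p}` smooth at every point over `b = σ(y)`, then there is an open `O ∋ b` of `𝔸ˢ_Y`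
over which every local ring of `X_σ` is regular (the fibre-in-the-smooth-locus condition is open
in `b` because `π` is closed; at a point `z` over `x ∈ X₁`, `𝒪_{X_σ,z} = 𝒪_{X₁,x}/(tᵢ - gᵢᵖ)`
and `stub_pthPowerSliceAlgebra` applies). [cite: EGAIV4, 17.11.1; Matsumura1987, Thm. 14.2] -/
theorem stub_sliceRegular :
    ∀ p : ℕ, p.Prime → ∀ (Y : Scheme.{0}) (f : Y ⟶ Spec (.of (ZMod p))) (s : ℕ)
      (V₁ : (AffineSpace (Fin s) Y).Opens) (X₁ : Scheme.{0}) (π : X₁ ⟶ (V₁ : Scheme.{0}))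
      [IsProper π] [LocallyOfFinitePresentation (π ≫ V₁.ι ≫ AffineSpace.map (Fin s) f)],
      Scheme.IsRegular X₁ →
      ∀ (V : Y.Opens) (y : Y) (hyV : y ∈ V) (g : Fin s → Γ((V : Scheme.{0}), ⊤)),
      (AffineSpace.homOfVector V.ι (fun i => g i ^ p)).base ⟨y, hyV⟩ ∈ V₁ →
      (∀ x : X₁, (π ≫ V₁.ι).base x = (AffineSpace.homOfVector V.ι (fun i => g i ^ p)).base ⟨y, hyV⟩ →
          x ∈ (π ≫ V₁.ι ≫ AffineSpace.map (Fin s) f).smoothLocus) →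
      ∃ O : (AffineSpace (Fin s) Y).Opens,
        (AffineSpace.homOfVector V.ι (fun i => g i ^ p)).base ⟨y, hyV⟩ ∈ O ∧
        ∀ z : ↥(pullback (π ≫ V₁.ι) (AffineSpace.homOfVector V.ι (fun i => g i ^ p))),
          (pullback.fst (π ≫ V₁.ι) (AffineSpace.homOfVector V.ι (fun i => g i ^ p)) ≫
              π ≫ V₁.ι).base z ∈ O →
          IsRegularLocalRing ((pullback (π ≫ V₁.ι)
            (AffineSpace.homOfVector V.ι (fun i => g i ^ p))).presheaf.stalk z) :=
  Summit.ResolutionOfSingularities.ResolutionOfSingularities.Theorems.ProductDescent.Birth.stub_sliceRegular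

/-- **CLOSED STUB (landed p151075, `Theorems/UniversalCellsProductDescentComponentsClopen.lean`) COMPONENTS OF A LOCALLY INTEGRAL NOETHERIAN SCHEME ARE CLOPEN.** If the
underlying space of `X` is Noetherian and every local ring of `X` is a domain, then every
irreducible component of `X` is open and closed (two components through `x` would give two
minimal primes of `𝒪_{X,x}`). [folklore] -/
theorem stub_componentsClopen :
    ∀ (X : Scheme.{0}), TopologicalSpace.NoetherianSpace X →
      (∀ x : X, IsDomain (X.presheaf.stalk x)) →
      ∀ C ∈ irreducibleComponents (X : Type), IsClopen C :=
  Summit.ResolutionOfSingularities.ResolutionOfSingularities.Theorems.ProductDescent.Birth.stub_componentsClopen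

/-- **CLOSED STUB (landed p151654, `Theorems/UniversalCellsProductDescentSliceResolution.lean`) THE SLICE RESOLVES A NEIGHBOURHOOD OF `y`.** For a section
`σ = (vᵢ)ᵢ : V → 𝔸ˢ_Y`, a proper `π : X₁ → V₁ ⊆ 𝔸ˢ_Y` which is an isomorphism over an open
`Ω ⊆ V₁` containing the generic value `σ(η_Y)`, and an open `O ∋ σ(y)`, `O ⊆ V₁`, over which the
sliced scheme `X_σ = X₁ ×_{𝔸ˢ_Y} V` has regular local rings: `y` has an open neighbourhood `U`
in `Y` with a resolution — namely `U = σ⁻¹(O)` resolved by the union of those (clopen,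
`stub_componentsClopen`) components of `X_σ|_U` that meet the isomorphism locus (proper: base
change of `π`; birational: iso over `σ⁻¹(Ω) ∩ U ∋ η_Y`, dense preimage by the choice of
components; regular by hypothesis). [folklore] -/
theorem stub_sliceResolution :
    ∀ p : ℕ, p.Prime → ∀ (Y : Scheme.{0}) (f : Y ⟶ Spec (.of (ZMod p))) [IsIntegral Y]
      [LocallyOfFiniteType f] [QuasiCompact f] (s : ℕ)
      (V₁ : (AffineSpace (Fin s) Y).Opens) (X₁ : Scheme.{0}) (π : X₁ ⟶ (V₁ : Scheme.{0}))
      [IsProper π] (V : Y.Opens) (y : Y) (hyV : y ∈ V) (v : Fin s → Γ((V : Scheme.{0}), ⊤))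
      (Ω : (AffineSpace (Fin s) Y).Opens), Ω ≤ V₁ → IsIso (π ∣_ (V₁.ι ⁻¹ᵁ Ω)) →
      (∀ x : (V : Scheme.{0}), V.ι.base x = genericPoint Y →
          (AffineSpace.homOfVector V.ι v).base x ∈ Ω) →
      ∀ (O : (AffineSpace (Fin s) Y).Opens), (AffineSpace.homOfVector V.ι v).base ⟨y, hyV⟩ ∈ O →
      O ≤ V₁ →
      (∀ z : ↥(pullback (π ≫ V₁.ι) (AffineSpace.homOfVector V.ι v)),
          (pullback.fst (π ≫ V₁.ι) (AffineSpace.homOfVector V.ι v) ≫ π ≫ V₁.ι).base z ∈ O →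
          IsRegularLocalRing ((pullback (π ≫ V₁.ι)
            (AffineSpace.homOfVector V.ι v)).presheaf.stalk z)) →
      ∃ U : Y.Opens, y ∈ U ∧ Scheme.HasResolution (U : Scheme.{0}) :=
  Summit.ResolutionOfSingularities.ResolutionOfSingularities.Theorems.ProductDescent.Birth.stub_sliceResolution

/-! ## Side results of rev L3 (landed in wave 1): the generic-fibre transfer -/

/-- **CLOSED STUB (landed p147873, `Theorems/UniversalCellsProductDescentResolutionPullback.lean`).**
Resolutions pull back along flat preimmersions whose range contains the generic point (non-affine
form of "resolutions localize"). [cite: EGAIV3, 8.10.5] -/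
theorem stub_resolutionPullback :
    ∀ (X Z : Scheme.{0}) (ι : Z ⟶ X) [IsIntegral X] [Flat ι] [IsPreimmersion ι],
      genericPoint X ∈ Set.range ι.base → Scheme.HasResolution X → Scheme.HasResolution Z :=
  Summit.ResolutionOfSingularities.ResolutionOfSingularities.Theorems.ProductDescent.Birth.stub_resolutionPullback

/-- **CLOSED STUB (landed p148881, `Theorems/UniversalCellsProductDescentGenericFibreEmbedding.lean`).**
The constant-field extension `Y ×_{𝔽_p} Spec 𝔽_p(t₁,…,t_s)` maps to `𝔸ˢ_Y` over `Y` by a flat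
preimmersion whose range contains every point of `𝔸ˢ_Y` with the same image in `𝔸ˢ_{𝔽_p}` as
the generic point of `𝔸ˢ_Y`. [folklore] -/
theorem stub_genericFibreEmbedding :
    ∀ p : ℕ, p.Prime → ∀ (Y : Scheme.{0}) (f : Y ⟶ Spec (.of (ZMod p))) [IsIntegral Y] (s : ℕ),
      ∃ ι : pullback f (Spec.map (CommRingCat.ofHom (algebraMap (ZMod p)
          (FractionRing (MvPolynomial (Fin s) (ZMod p)))))) ⟶ AffineSpace (Fin s) Y,
        ι ≫ (CategoryTheory.over (AffineSpace (Fin s) Y) Y) = pullback.fst f _ ∧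
        Flat ι ∧ IsPreimmersion ι ∧
        ∀ ξ : ↥(AffineSpace (Fin s) Y),
          (AffineSpace.map (Fin s) f).base ξ =
            (AffineSpace.map (Fin s) f).base (genericPoint (AffineSpace (Fin s) Y)) →
          ξ ∈ Set.range ι.base :=
  Summit.ResolutionOfSingularities.ResolutionOfSingularities.Theorems.ProductDescent.Birth.stub_genericFibreEmbedding

/-- **CLOSED STUB (landed p147981, `Theorems/UniversalCellsProductDescentFibreGenericPoint.lean`).**
Every point `x` of `𝔸ˢ_Y` is a specialisation of a point `ξ` over the same point of `Y` having
the same image in `𝔸ˢ_{𝔽_p}` as the generic point of `𝔸ˢ_Y`. [folklore] -/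
theorem stub_fibreGenericPoint :
    ∀ p : ℕ, p.Prime → ∀ (Y : Scheme.{0}) (f : Y ⟶ Spec (.of (ZMod p))) [IsIntegral Y] (s : ℕ)
      (x : ↥(AffineSpace (Fin s) Y)),
      ∃ ξ : ↥(AffineSpace (Fin s) Y), ξ ⤳ x ∧
        (CategoryTheory.over (AffineSpace (Fin s) Y) Y).base ξ =
          (CategoryTheory.over (AffineSpace (Fin s) Y) Y).base x ∧
        (AffineSpace.map (Fin s) f).base ξ =
          (AffineSpace.map (Fin s) f).base (genericPoint (AffineSpace (Fin s) Y)) :=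
  Summit.ResolutionOfSingularities.ResolutionOfSingularities.Theorems.ProductDescent.Birth.stub_fibreGenericPoint

/-- The generic point of a non-empty open subscheme of an irreducible scheme maps to the generic
point of the ambient scheme. [folklore] -/
theorem ι_genericPoint_opens {X : Scheme.{0}} [IrreducibleSpace X] (V : X.Opens)
    [Nonempty V] [IrreducibleSpace V] :
    V.ι.base (genericPoint (V : Scheme.{0})) = genericPoint X := by
  have hgen : IsGenericPoint (V.ι.base (genericPoint (V : Scheme.{0})))
      (closure (V.ι.base '' (Set.univ : Set V))) :=
    (genericPoint_spec (V : Scheme.{0})).image V.ι.base.hom.continuous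
  have hrange : V.ι.base '' (Set.univ : Set V) = (V : Set X) := by
    rw [Set.image_univ]; exact Scheme.Opens.range_ι V
  have hdense : closure (V.ι.base '' (Set.univ : Set V)) = Set.univ := by
    rw [hrange, ← dense_iff_closure_eq]
    exact V.2.dense (by obtain ⟨⟨v, hv⟩⟩ := ‹Nonempty V›; exact ⟨v, hv⟩)
  rw [hdense] at hgen
  exact hgen.eq (by simpa using genericPoint_spec X)

/-- **GENERIC-FIBRE TRANSFER** (EGA IV₃ 8.10.5; derived from the three landed stubs): a
resolvable open neighbourhood of `w` in `W ⊆ 𝔸ˢ_Y` gives a point `y'` of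
`Y ×_{𝔽_p} Spec 𝔽_p(t₁,…,t_s)` over the image of `w` in `Y` with a resolvable open
neighbourhood. Not on the rev-L5 chain; kept for provers of `stub_separabilisation` who start
from the generic fibre. [cite: EGAIV3, 8.10.5] -/
theorem genericFibre :
    ∀ p : ℕ, p.Prime → ∀ (Y : Scheme.{0}) (f : Y ⟶ Spec (.of (ZMod p))),
      IsSeparated f → LocallyOfFiniteType f → QuasiCompact f → IsIntegral Y →
      ∀ (s : ℕ) (W : Scheme.{0}) (j : W ⟶ AffineSpace (Fin s) Y), IsOpenImmersion j →
      ∀ w : W, (∃ W' : W.Opens, w ∈ W' ∧ Scheme.HasResolution (W' : Scheme.{0})) →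
      ∃ y' : ↥(pullback f (Spec.map (CommRingCat.ofHom (algebraMap (ZMod p)
          (FractionRing (MvPolynomial (Fin s) (ZMod p))))))),
        (pullback.fst f _).base y' = (CategoryTheory.over (AffineSpace (Fin s) Y) Y).base (j.base w) ∧
        ∃ U' : (pullback f (Spec.map (CommRingCat.ofHom (algebraMap (ZMod p)
          (FractionRing (MvPolynomial (Fin s) (ZMod p))))))).Opens,
          y' ∈ U' ∧ Scheme.HasResolution (U' : Scheme.{0}) := by
  intro p hp Y f _ _ _ hY s W j hj w ⟨W', hw, hres⟩
  obtain ⟨ι, hιover, hflat, hpre, hrange⟩ := stub_genericFibreEmbedding p hp Y f s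
  set x : ↥(AffineSpace (Fin s) Y) := j.base w with hx
  obtain ⟨ξ, hξx, hξy, hξη⟩ := stub_fibreGenericPoint p hp Y f s x
  obtain ⟨y', hy'⟩ := hrange ξ hξη
  set V : (AffineSpace (Fin s) Y).Opens := j ''ᵁ W' with hV
  have hxV : x ∈ V := ⟨w, hw, rfl⟩
  have hξV : ξ ∈ V := hξx.mem_open V.2 hxV
  refine ⟨y', ?_, ι ⁻¹ᵁ V, ?_, ?_⟩
  · have : (pullback.fst f _).base y' =
        (CategoryTheory.over (AffineSpace (Fin s) Y) Y).base (ι.base y') := by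
      rw [← hιover]; rfl
    rw [this, hy', hξy]
  · change ι.base y' ∈ V
    rwa [hy']
  · haveI : Nonempty V := ⟨⟨x, hxV⟩⟩
    haveI := hflat
    haveI := hpre
    have hresV : Scheme.HasResolution (V : Scheme.{0}) :=
      Scheme.HasResolution.of_iso (j.isoImage W').hom hres
    refine stub_resolutionPullback (V : Scheme.{0}) (ι ⁻¹ᵁ V : Scheme.{0}) (ι ∣_ V) ?_ hresV
    obtain ⟨z, hz⟩ := hrange (genericPoint (AffineSpace (Fin s) Y)) rfl
    have hzV : z ∈ ι ⁻¹ᵁ V := by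
      change ι.base z ∈ V
      rw [hz, ← ι_genericPoint_opens V]
      exact (genericPoint (V : Scheme.{0})).2
    refine ⟨⟨z, hzV⟩, ?_⟩
    apply Subtype.ext
    rw [morphismRestrict_base_coe, hz, ← ι_genericPoint_opens V]
    rfl

/-! ## The composition (kernel-checked; no `sorry` of its own) -/

/-- **The crux `ProductDescent`, assembled** — the only `sorry` in its closure is the registered
open stub `stub_separabilisation`: the whole p-th power section method (generic point via the
regular locus; wiggle; regularity of the slice since `d(gᵖ) = 0`; resolution of the neighbourhood)
is the LANDED conditional theorem `ProductDescent_of_separabilisation`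
(`Theorems/UniversalCellsProductDescentSliceWiggle.lean`, p154192), applied to the stub.
[cite: EGAIV4, 17.11.1; Matsumura1987, Thm. 14.2] -/
theorem ProductDescent_proof : ProductDescent :=
  Summit.ResolutionOfSingularities.ResolutionOfSingularities.Theorems.ProductDescent.Birth.ProductDescent_of_separabilisation
    stub_separabilisation

end Summit.ResolutionOfSingularities.ResolutionOfSingularities.Cruxes.ProductDescent.Lines.Birth

end
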